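import Summits.RiemannHypothesis.RiemannHypothesis.Theorems.Splittings.LinearRayLehmerWindowLowDefs
import Summits.RiemannHypothesis.RiemannHypothesis.Theorems.Splittings.LinearRayLehmerWindowQ

/-!
# The linear-factor ray at Lehmer's pair — soundness of the sub-unity forward average

Cell rh-split (D-0116 arm), ENGINE 5 (rh-splitx-eng-5 g4), lane (xviii-D) «LEHMER WINDOW DATA», ADDENDUM,
part LOW-Q.  `tailQ_decay`: the forward tail at the DECAY-AWARE rate,
`∫_{y>Y} ‖H_0(2t₀+y) e^{−ay}‖ dy ≤ K₀·C(t₀)(t₀+1)³ e^{−(a+3/8)Y}/(a+3/8)` for every `a ≥ 0` (`t₀ ≥ 7000`;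
the engine's `UniversalFactor.norm_deBruijnH_zero_two_mul_le` keeps the factor `e^{−πy/8}`, of which
`e^{−3y/8}` survives the cubic); `ldTailQ_sound`; `ldQL_sound` = `ldQ_sound` with this tail (so only
`a > 0` is needed); `ldBoxCheckL_sound`, `ldQRunWithL_sound`.
HONEST LABEL: RH-free negative-side bookkeeping on the linear-factor ray (RH-strengthening via
`riemannHypothesis_of_exists_linearRay`); not a splitting; nothing here bears on the truth of RH.
-/

set_option linter.dupNamespace false

noncomputable section

namespace Summit.RiemannHypothesis.RiemannHypothesis.Theorems.Splittings.LinearRayLehmerWindow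

open Set MeasureTheory
open Literature.NumberTheory.LFunctions Literature.NumberTheory.LFunctions.ZetaNumerics
open Literature.Analysis.ValidatedNumerics Literature.Analysis.ValidatedNumerics.NumericsMP

/-! ## The decay-aware forward tail -/

/-- `(t₀ + y/2 + 1)³ e^{−πy/8} ≤ (t₀+1)³ e^{−3y/8}` for `t₀ ≥ 7000`, `y ≥ 0`. [folklore] -/
theorem cube_mul_exp_le_decay {t₀ y : ℝ} (ht₀ : 7000 ≤ t₀) (hy : 0 ≤ y) :
    (t₀ + y / 2 + 1) ^ 3 * Real.exp (-(Real.pi / 8 * y)) ≤ (t₀ + 1) ^ 3 * Real.exp (-(3 / 8 * y)) := by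
  have h1 : 0 < t₀ + 1 := by linarith
  set u : ℝ := y / (2 * (t₀ + 1)) with hu
  have hu0 : 0 ≤ u := by positivity
  have hfac : t₀ + y / 2 + 1 = (t₀ + 1) * (1 + u) := by rw [hu]; field_simp; ring
  have hexp : (1 + u) ^ 3 ≤ Real.exp ((Real.pi / 8 - 3 / 8) * y) := by
    have h2 : 1 + u ≤ Real.exp u := by linarith [Real.add_one_le_exp u]
    have h3 : (1 + u) ^ 3 ≤ Real.exp u ^ 3 := pow_le_pow_left₀ (by linarith) h2 3
    have h4 : Real.exp u ^ 3 = Real.exp (3 * u) := by rw [← Real.exp_nat_mul]; norm_num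
    have h5 : 3 * u ≤ (Real.pi / 8 - 3 / 8) * y := by
      rw [hu]
      have : 3 * (y / (2 * (t₀ + 1))) = (3 / (2 * (t₀ + 1))) * y := by ring
      rw [this]
      refine mul_le_mul_of_nonneg_right ?_ hy
      rw [div_le_iff₀ (by positivity)]
      nlinarith [Real.pi_gt_d2]
    calc (1 + u) ^ 3 ≤ Real.exp u ^ 3 := h3
      _ = Real.exp (3 * u) := h4
      _ ≤ Real.exp ((Real.pi / 8 - 3 / 8) * y) := Real.exp_le_exp.2 h5
  rw [hfac, mul_pow]
  have hsplit : Real.exp (-(3 / 8 * y)) = Real.exp ((Real.pi / 8 - 3 / 8) * y) * Real.exp (-(Real.pi / 8 * y)) := by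
    rw [← Real.exp_add]; congr 1; ring
  rw [hsplit]
  have hT : 0 ≤ (t₀ + 1) ^ 3 := pow_nonneg h1.le 3
  have hE : 0 ≤ Real.exp (-(Real.pi / 8 * y)) := (Real.exp_pos _).le
  calc (t₀ + 1) ^ 3 * (1 + u) ^ 3 * Real.exp (-(Real.pi / 8 * y))
      ≤ (t₀ + 1) ^ 3 * Real.exp ((Real.pi / 8 - 3 / 8) * y) * Real.exp (-(Real.pi / 8 * y)) :=
        mul_le_mul_of_nonneg_right (mul_le_mul_of_nonneg_left hexp hT) hE
    _ = (t₀ + 1) ^ 3 * (Real.exp ((Real.pi / 8 - 3 / 8) * y) * Real.exp (-(Real.pi / 8 * y))) := by ring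

/-- **Forward tail, decay-aware rate.** For `t₀ ≥ 7000`, `a ≥ 0`, `Y ≥ 0`:
`∫_{y>Y} ‖H_0(2t₀ + y) e^{−ay}‖ dy ≤ K₀ · C(t₀)(t₀+1)³ e^{−(a+3/8)Y}/(a+3/8)`. [folklore] -/
theorem tailQ_decay {t₀ a Y : ℝ} (ht₀ : 7000 ≤ t₀) (ha : 0 ≤ a) (hY : 0 ≤ Y) :
    ∫ y in Set.Ioi Y, ‖deBruijnH 0 (((2 * t₀ : ℝ) : ℂ) + (y : ℂ)) * (Real.exp (-(a * y)) : ℂ)‖ ≤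
      UniversalFactor.lehmerK0 t₀ *
        (UniversalFactor.lehmerTailConst t₀ * (t₀ + 1) ^ 3 * Real.exp (-((a + 3 / 8) * Y)) / (a + 3 / 8)) := by
  have hb0 : 0 < a + 3 / 8 := by linarith
  set A : ℝ := UniversalFactor.lehmerK0 t₀ * UniversalFactor.lehmerTailConst t₀ * (t₀ + 1) ^ 3 with hA
  have hK := UniversalFactor.lehmerK0_pos t₀
  have hC : 0 < UniversalFactor.lehmerTailConst t₀ := by
    unfold UniversalFactor.lehmerTailConst; positivity
  have hA0 : 0 ≤ A := by positivity
  -- pointwise bound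
  have hpt : ∀ y ∈ Ioi Y, ‖deBruijnH 0 (((2 * t₀ : ℝ) : ℂ) + (y : ℂ)) * (Real.exp (-(a * y)) : ℂ)‖ ≤
      A * Real.exp (-(a + 3 / 8) * y) := by
    intro y hy
    have hy0 : 0 ≤ y := hY.trans (le_of_lt hy)
    rw [norm_mul, Complex.norm_real, Real.norm_of_nonneg (Real.exp_pos _).le,
      show (((2 * t₀ : ℝ) : ℂ) + (y : ℂ)) = ((2 * (t₀ + y / 2) : ℝ) : ℂ) by push_cast; ring]
    have h := UniversalFactor.norm_deBruijnH_zero_two_mul_le (t₀ := t₀) (t := t₀ + y / 2)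
      (by linarith) (by linarith)
    have hcube := cube_mul_exp_le_decay ht₀ hy0
    have e1 : Real.exp (Real.pi / 4 * (t₀ - (t₀ + y / 2))) = Real.exp (-(Real.pi / 8 * y)) := by
      congr 1; ring
    rw [e1] at h
    have e2 : Real.exp (-(a * y)) * Real.exp (-(3 / 8 * y)) = Real.exp (-(a + 3 / 8) * y) := by
      rw [← Real.exp_add]; congr 1; ring
    calc ‖deBruijnH 0 ((2 * (t₀ + y / 2) : ℝ) : ℂ)‖ * Real.exp (-(a * y))
        ≤ UniversalFactor.lehmerK0 t₀ * UniversalFactor.lehmerTailConst t₀ * (t₀ + y / 2 + 1) ^ 3 *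
            Real.exp (-(Real.pi / 8 * y)) * Real.exp (-(a * y)) :=
          mul_le_mul_of_nonneg_right h (Real.exp_pos _).le
      _ = UniversalFactor.lehmerK0 t₀ * UniversalFactor.lehmerTailConst t₀ *
            ((t₀ + y / 2 + 1) ^ 3 * Real.exp (-(Real.pi / 8 * y))) * Real.exp (-(a * y)) := by ring
      _ ≤ UniversalFactor.lehmerK0 t₀ * UniversalFactor.lehmerTailConst t₀ *
            ((t₀ + 1) ^ 3 * Real.exp (-(3 / 8 * y))) * Real.exp (-(a * y)) := by gcongr
      _ = A * Real.exp (-(a + 3 / 8) * y) := by rw [hA, ← e2]; ring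
  -- integrate the majorant
  have hg : IntegrableOn (fun y : ℝ => A * Real.exp (-(a + 3 / 8) * y)) (Ioi Y) :=
    (integrableOn_exp_mul_Ioi (by linarith) Y).const_mul A
  have hmono := integral_mono_of_nonneg (μ := volume.restrict (Ioi Y))
    (Filter.Eventually.of_forall fun y => norm_nonneg
      (deBruijnH 0 (((2 * t₀ : ℝ) : ℂ) + (y : ℂ)) * (Real.exp (-(a * y)) : ℂ)))
    hg ((ae_restrict_iff' measurableSet_Ioi).2 (Filter.Eventually.of_forall hpt))
  refine hmono.trans (le_of_eq ?_)
  rw [integral_const_mul, integral_exp_mul_Ioi (by linarith) Y, hA, neg_div_neg_eq,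
    show -(a + 3 / 8) * Y = -((a + 3 / 8) * Y) by ring]
  ring

/-- **Soundness of `ldTailQ`**: for every `a ≥ a₁ = A₁/AD` (`AD > 0`), the decay-aware tail constant of
`tailQ_decay` at `Y = 4CyF/ρD` is at most `tQ`. [folklore] -/
theorem ldTailQ_sound {C : UniversalFactor.LCtx} (hC : C.Valid) {ρD CyF A₁ AD : ℕ} (hρ : 0 < ρD) (hAD : 0 < AD)
    {tQ : ℚ} (h : ldTailQ C ρD CyF A₁ AD = some tQ) {a : ℝ} (h1 : (A₁ : ℝ) / AD ≤ a) :
    UniversalFactor.lehmerTailConst UniversalFactor.lehmerT0 * (UniversalFactor.lehmerT0 + 1) ^ 3 *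
        Real.exp (-((a + 3 / 8) * (4 * CyF / ρD))) / (a + 3 / 8) ≤ (tQ : ℝ) := by
  have hS := hC.tv.S_pos
  have hSr : (0 : ℝ) < C.T.S := by exact_mod_cast hS
  have hρr : (0 : ℝ) < ρD := by exact_mod_cast hρ
  have hADr : (0 : ℝ) < AD := by exact_mod_cast hAD
  have ha₁ : (0 : ℝ) ≤ (A₁ : ℝ) / AD := by positivity
  have ha : 0 ≤ a := ha₁.trans h1
  unfold ldTailQ at h
  simp only [Option.bind_eq_some_iff, Option.map_eq_some_iff] at h
  obtain ⟨LN, hLN, LD, hLD, EC, hEC, E2, hE2, htQ⟩ := h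
  have mA := UniversalFactor.hiTailConst_mem hC hLN hLD hEC
  set Aconst : ℝ := UniversalFactor.lehmerTailConst UniversalFactor.lehmerT0 * (UniversalFactor.lehmerT0 + 1) ^ 3 with hAconst
  have hA0 : 0 ≤ Aconst := by
    rw [hAconst]
    have : 0 < UniversalFactor.lehmerTailConst UniversalFactor.lehmerT0 := by
      unfold UniversalFactor.lehmerTailConst; positivity
    have ht : (0 : ℝ) ≤ UniversalFactor.lehmerT0 + 1 := by
      unfold UniversalFactor.lehmerT0 UniversalFactor.lehmerT0N UniversalFactor.lehmerT0D; norm_num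
    positivity
  -- the exponential at `a₁`
  have hq8 : 0 < 8 * ρD * AD := by positivity
  have mE := MI.mem_exp hS hE2 (MI.mem_ofFrac C.T.S (-(4 * (CyF : ℤ) * (8 * (A₁ : ℤ) + 3 * AD))) hq8)
  have e1 : ((-(4 * (CyF : ℤ) * (8 * (A₁ : ℤ) + 3 * AD)) : ℤ) : ℝ) / ((8 * ρD * AD : ℕ) : ℝ) =
      -(((A₁ : ℝ) / AD + 3 / 8) * (4 * CyF / ρD)) := by
    push_cast
    field_simp
  rw [e1] at mE
  have mP := MI.mem_mul hS mA mE
  have hP := MI.le_hi_div hS mP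
  -- monotonicity in `a`
  have hb₁ : 0 < (A₁ : ℝ) / AD + 3 / 8 := by linarith
  have hb : 0 < a + 3 / 8 := by linarith
  have hexp : Real.exp (-((a + 3 / 8) * (4 * CyF / ρD))) ≤ Real.exp (-(((A₁ : ℝ) / AD + 3 / 8) * (4 * CyF / ρD))) := by
    apply Real.exp_le_exp.2
    have hY : (0 : ℝ) ≤ 4 * CyF / ρD := by positivity
    nlinarith [mul_le_mul_of_nonneg_right h1 hY]
  have hinv : 1 / (a + 3 / 8) ≤ 1 / ((A₁ : ℝ) / AD + 3 / 8) := one_div_le_one_div_of_le hb₁ (by linarith)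
  have hstep : Aconst * Real.exp (-((a + 3 / 8) * (4 * CyF / ρD))) / (a + 3 / 8) ≤
      Aconst * Real.exp (-(((A₁ : ℝ) / AD + 3 / 8) * (4 * CyF / ρD))) * (1 / ((A₁ : ℝ) / AD + 3 / 8)) := by
    rw [div_eq_mul_one_div]
    exact mul_le_mul (mul_le_mul_of_nonneg_left hexp hA0) hinv (by positivity) (by positivity)
  refine hstep.trans ?_
  rw [← htQ]
  have e8 : 1 / ((A₁ : ℝ) / AD + 3 / 8) = 8 * (AD : ℝ) / (8 * A₁ + 3 * AD) := by
    field_simp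
  rw [e8]
  push_cast
  have hden : (0 : ℝ) < 8 * A₁ + 3 * AD := by positivity
  have hfrac : (0 : ℝ) ≤ 8 * (AD : ℝ) / (8 * A₁ + 3 * AD) := by positivity
  calc Aconst * Real.exp (-(((A₁ : ℝ) / AD + 3 / 8) * (4 * CyF / ρD))) * (8 * (AD : ℝ) / (8 * A₁ + 3 * AD))
      ≤ ((((MI.mul C.T.S (MI.mul C.T.S (EC.mulInt 5)
          (MI.ofFrac C.T.S (((UniversalFactor.lehmerT0N + UniversalFactor.lehmerT0D) ^ 3 : ℕ) : ℤ)
            (UniversalFactor.lehmerT0D ^ 3))) E2).hi : ℤ) : ℝ) / C.T.S) * (8 * (AD : ℝ) / (8 * A₁ + 3 * AD)) :=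
        mul_le_mul_of_nonneg_right hP hfrac
    _ = ((((MI.mul C.T.S (MI.mul C.T.S (EC.mulInt 5)
          (MI.ofFrac C.T.S (((UniversalFactor.lehmerT0N + UniversalFactor.lehmerT0D) ^ 3 : ℕ) : ℤ)
            (UniversalFactor.lehmerT0D ^ 3))) E2).hi : ℤ) : ℝ) / C.T.S) * (8 * (AD : ℝ)) / (8 * A₁ + 3 * AD) := by
        ring

/-! ## The box and the window -/

/-- **Soundness of `ldQL`**: for every `a ∈ [A₁/AD, A₂/AD]` (`0 < A₁`), `K₀ · q ≤ Q_a(x₀)`. [folklore] -/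
theorem ldQL_sound {C : UniversalFactor.LCtx} (hC : C.Valid) (hCt0 : C.t0 = UniversalFactor.lehmerT0)
    {ρD CyB CyF : ℕ} {pt : UniversalFactor.HiPoint} (hpt : UniversalFactor.hiPointData C ρD CyB CyF = some pt)
    (hρ8 : 8 ≤ ρD) (hF : 2 * CyF ≤ 10 * ρD + 1) {A₁ A₂ AD : ℕ} (hAD : 0 < AD) (hA₁ : 0 < A₁)
    {q : ℚ} (h : ldQL C pt CyB CyF A₁ A₂ AD = some q) {a : ℝ} (h1 : (A₁ : ℝ) / AD ≤ a) (h2 : a ≤ (A₂ : ℝ) / AD) :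
    UniversalFactor.lehmerK0 UniversalFactor.lehmerT0 * (q : ℝ) ≤
      (∫ y in Ioi (0:ℝ), deBruijnH 0 (((2 * UniversalFactor.lehmerT0 : ℝ) : ℂ) + y) * (Real.exp (-(a * y)) : ℂ)).re := by
  have hS := hC.tv.S_pos
  have hSr : (0 : ℝ) < C.T.S := by exact_mod_cast hS
  have hρ : 0 < ρD := lt_of_lt_of_le (by norm_num) hρ8
  have hρr : (0 : ℝ) < ρD := by exact_mod_cast hρ
  have hADr : (0 : ℝ) < AD := by exact_mod_cast hAD
  have ha₁ : (0 : ℝ) < (A₁ : ℝ) / AD := by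
    have : (0 : ℝ) < A₁ := by exact_mod_cast hA₁
    positivity
  have ha0 : 0 < a := lt_of_lt_of_le ha₁ h1
  have hK := UniversalFactor.lehmerK0_pos UniversalFactor.lehmerT0
  set t₀ : ℝ := UniversalFactor.lehmerT0 with ht₀def
  have ht₀ : 7000 ≤ t₀ ∧ t₀ ≤ 7010 := by
    rw [ht₀def]; unfold UniversalFactor.lehmerT0 UniversalFactor.lehmerT0N UniversalFactor.lehmerT0D; norm_num
  obtain ⟨hptρ, -, hfwd, -⟩ := UniversalFactor.hiPointData_spec hpt
  unfold ldQL at h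
  simp only at h
  split at h
  · rename_i EcB1 EcB2 EnB1 EnB2 EcF1 EcF2 EnF1 EnF2 eQ tQ htabs heQ htail
    simp only [Option.some.injEq] at h
    rw [hptρ] at htabs heQ htail h
    unfold UniversalFactor.hiBoxTabs at htabs
    split at htabs
    · rename_i EcB1' EcB2' EnB1' EnB2' hEcB1 hEcB2 hEnB1 hEnB2
      split at htabs
      · rename_i EcF1' EcF2' EnF1' EnF2' hEcF1 hEcF2 hEnF1 hEnF2
        simp only [Option.some.injEq, Prod.mk.injEq] at htabs
        obtain ⟨⟨rfl, rfl, rfl, rfl⟩, ⟨rfl, rfl, rfl, rfl⟩⟩ := htabs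
        have htQ := ldTailQ_sound hC hρ hAD htail h1
        rw [← ht₀def] at htQ
        have hcore := UniversalFactor.hiSide_core hC hCt0 hρ8 true hF hfwd hAD hEcF1 hEcF2 hEnF1 hEnF2 heQ h1 h2 (2 * a) rfl
        rw [← ht₀def] at hcore
        have hdec := UniversalFactor.stub_highSideQ t₀ a (1 / ρD) CyF ha0 (by positivity)
        have hcells : ∀ c : ℕ, t₀ + (2 * c + 1) * (1 / ρD) = UniversalFactor.hiCellT ρD true c := by
          intro c; rw [UniversalFactor.hiCellT_eq hρ, ← ht₀def]; simp; ring
        simp only [hcells] at hdec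
        have htail := tailQ_decay (t₀ := t₀) (a := a) (Y := 4 * (1 / ρD) * CyF) ht₀.1 ha0.le (by positivity)
        have hre : |(∫ y in Ioi (4 * (1 / (ρD : ℝ)) * CyF),
            deBruijnH 0 (((2 * t₀ : ℝ) : ℂ) + y) * (Real.exp (-(a * y)) : ℂ)).re| ≤
            UniversalFactor.lehmerK0 t₀ * (tQ : ℝ) := by
          refine (Complex.abs_re_le_norm _).trans ((norm_integral_le_integral_norm _).trans (htail.trans ?_))
          refine mul_le_mul_of_nonneg_left ?_ hK.le
          have e : (a + 3 / 8) * (4 * (1 / (ρD : ℝ)) * CyF) = (a + 3 / 8) * (4 * CyF / ρD) := by ring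
          rw [e]; exact htQ
        have hre' := (abs_le.1 hre).1
        set sh : ℝ := (((UniversalFactor.hiSideSum C.T.S ρD pt.fwd EnF1' EnF2' EcF1' EcF2' CyF).hi : ℤ) : ℝ) with hsh
        have hq : (q : ℝ) = -(2 * (sh / (C.T.S : ℝ) + (eQ : ℝ)) + (tQ : ℝ)) := by
          rw [← h, hsh]; push_cast; ring
        have e2 : UniversalFactor.lehmerK0 t₀ * (-(2 * (sh / (C.T.S : ℝ) + (eQ : ℝ)) + (tQ : ℝ))) =
            2 * (-(UniversalFactor.lehmerK0 t₀ * (sh / (C.T.S : ℝ) + (eQ : ℝ)))) - UniversalFactor.lehmerK0 t₀ * (tQ : ℝ) := by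
          ring
        rw [hdec, hq, e2]
        linarith [hcore, hre']
      · simp at htabs
    · simp at htabs
  · simp at h

/-- **Soundness of the sub-unity box check**: for every `a ∈ [A₁/AD, A₂/AD]` (`A₁ > 0`) there is a real
`q ≥ 0` with `K₀ · q ≤ Q_a(x₀)` and `(Ln/Ld)·M < e^{−a·Ln/Ld}·q`. [folklore] -/
theorem ldBoxCheckL_sound {C : UniversalFactor.LCtx} (hC : C.Valid) (hCt0 : C.t0 = UniversalFactor.lehmerT0)
    {ρD CyB CyF : ℕ} {pt : UniversalFactor.HiPoint} (hpt : UniversalFactor.hiPointData C ρD CyB CyF = some pt)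
    (hρ8 : 8 ≤ ρD) (hF : 2 * CyF ≤ 10 * ρD + 1) {A₁ A₂ AD Ln Ld : ℕ} (hAD : 0 < AD) (hA₁ : 0 < A₁) (hLd : 0 < Ld)
    {M : ℚ} (h : ldBoxCheckL C pt CyB CyF A₁ A₂ AD Ln Ld M = true) {a : ℝ} (h1 : (A₁ : ℝ) / AD ≤ a) (h2 : a ≤ (A₂ : ℝ) / AD) :
    ∃ q : ℝ, 0 ≤ q ∧
      UniversalFactor.lehmerK0 UniversalFactor.lehmerT0 * q ≤
        (∫ y in Ioi (0:ℝ), deBruijnH 0 (((2 * UniversalFactor.lehmerT0 : ℝ) : ℂ) + y) * (Real.exp (-(a * y)) : ℂ)).re ∧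
      ((Ln : ℝ) / Ld) * (M : ℝ) < Real.exp (-(a * ((Ln : ℝ) / Ld))) * q := by
  have hS := hC.tv.S_pos
  unfold ldBoxCheckL at h
  split at h
  · rename_i q e hq he
    simp only [Bool.and_eq_true, decide_eq_true_eq] at h
    obtain ⟨hq0, hmargin⟩ := h
    refine ⟨(q : ℝ), by exact_mod_cast hq0, ldQL_sound hC hCt0 hpt hρ8 hF hAD hA₁ hq h1 h2, ?_⟩
    have hexp := ldExpLo_sound hS hAD hLd he h2
    have hm : ((Ln : ℝ) / Ld) * (M : ℝ) < ((e : ℝ) / C.T.S) * (q : ℝ) := by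
      have h' := (Rat.cast_lt (K := ℝ)).2 hmargin
      push_cast at h'
      exact h'
    exact hm.trans_le (mul_le_mul_of_nonneg_right hexp (by exact_mod_cast hq0))
  · simp at h

/-- **Soundness of the sub-unity window check**: a passing `ldQRunWithL` gives, for every `a` of
`[As₀/AD, As_last/AD]`, a real `q ≥ 0` with `K₀ · q ≤ Q_a(x₀)` and `(Ln/Ld)·M < e^{−a·Ln/Ld}·q`; and `0 ≤ M`.
[folklore] -/
theorem ldQRunWithL_sound {oT : Option Tables} (hT : ∀ T, oT = some T → T.Valid)
    {ρD CyB CyF : ℕ} {As : List ℕ} {AD Ln Ld : ℕ} {M : ℚ} (h : ldQRunWithL oT ρD CyB CyF As AD Ln Ld M = true)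
    {a : ℝ} (hlo : (As.getD 0 0 : ℝ) / AD ≤ a) (hhi : a ≤ (As.getD (As.length - 1) 0 : ℝ) / AD) :
    0 ≤ M ∧ ∃ q : ℝ, 0 ≤ q ∧
      UniversalFactor.lehmerK0 UniversalFactor.lehmerT0 * q ≤
        (∫ y in Ioi (0:ℝ), deBruijnH 0 (((2 * UniversalFactor.lehmerT0 : ℝ) : ℂ) + y) * (Real.exp (-(a * y)) : ℂ)).re ∧
      ((Ln : ℝ) / Ld) * (M : ℝ) < Real.exp (-(a * ((Ln : ℝ) / Ld))) * q := by
  cases oT with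
  | none => simp [ldQRunWithL] at h
  | some T =>
    have hTv : T.Valid := hT T rfl
    unfold ldQRunWithL at h
    dsimp only at h
    split at h
    · simp at h
    · rename_i C hC
      obtain ⟨hCT, -, hN, hD⟩ := UniversalFactor.mkCtx_fields hC
      obtain ⟨h1, h2, h3, h4, h5, h6, h7⟩ := UniversalFactor.mkCtx_spec hTv hC
      have hCv : C.Valid := ⟨h1, h2, h3, h4, h5, h6, h7⟩
      have hCt0 : C.t0 = UniversalFactor.lehmerT0 := UniversalFactor.LCtx.t0_eq hN hD
      split at h
      · simp at h
      · rename_i pt hpt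
        unfold ldCoverCheckL at h
        simp only [Bool.and_eq_true, decide_eq_true_eq, List.all_eq_true, List.mem_range] at h
        obtain ⟨⟨hρ8, -, hF, hAD, hlen, hLd, hM⟩, hall⟩ := h
        have hptρ := (UniversalFactor.hiPointData_spec hpt).1
        rw [hptρ] at hρ8 hF
        refine ⟨hM, ?_⟩
        obtain ⟨k, hk, hk1, hk2⟩ := UniversalFactor.osa_cover_find As AD a hlo (As.length - 1) (by omega) hhi
        obtain ⟨hA₁, hbox⟩ := hall k hk
        exact ldBoxCheckL_sound hCv hCt0 hpt hρ8 hF hAD hA₁ hLd hbox hk1 hk2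

end Summit.RiemannHypothesis.RiemannHypothesis.Theorems.Splittings.LinearRayLehmerWindow

end
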